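import Summits.BirchSwinnertonDyer.BirchSwinnertonDyer.Theorems.TwoAdicConverseGoodTwistsKolyvaginBigImage
import Summits.BirchSwinnertonDyer.BirchSwinnertonDyer.Theorems.TwoAdicConverseGoodTwistsMult
import HarnessLib

/-!
# Route `TwoAdicConverse` (rung S3): the «a.e.-twist» rank statement on the WHOLE LEAF HABITAT — every
# non-CM curve good-ordinary OR MULTIPLICATIVE at `2` with surjective `2`-adic image — from Kolyvagin at `2`

Cell `bsd-2adic` (run/shared/lean/pub/bsd-2adic/), seat `bsd-2adic-conv-1` GEN 17, file F3 (leaf-habitat form of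
F2 `TwoAdicConverseGoodTwistsKolyvaginBigImage`, p607992; F1 = `TwoAdicConverseRankZeroKolyvaginBigImage`,
p607060). THEOREMS ONLY — no named fact, no axiom, no definition; every deep input is a named fact of the
tree or an OPEN route decl, carried as an explicit hypothesis.

The rung leaf `Rank1Residual.NonCMTwoConverse` quantifies over «non-CM, good ordinary OR multiplicative at
`2`». Both classes are closed under the good family `𝓕 = {d square-free, d ≡ 1 (mod 4)}` (unramified at
`2`): `TwoAdicGoodTwists.not_hasCM_and_goodOrd_of_smul_eq_quadraticTwist` (GEN 9) and
`TwoAdicGoodTwists.not_hasCM_and_mult_of_smul_eq_quadraticTwist` (the multiplicative twin, Tate normal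
form at `2`), and so is the big-image habitat (F2 §0,
`forall_hasSurjectiveModNGaloisRep_two_pow_of_smul_eq_quadraticTwist`: `−1 = J²` in `Aut(E[2^m])`). Hence
F1's leaf on the habitat (`nonCMTwoConverse_bigImage_of_kolyvaginAtTwo`: V1′ item 24622 + V2♭ item 24623 +
`NoTwoTorsionOverK` item 24405 + `PrintedInputsRankOneAtTwo` item 23951 + BFH + GZK) holds at every good
twist, and Smith's Thm. 1.1 gives, for EVERY globally minimal non-CM `W` good-ordinary or multiplicative
at `2` with `ρ_{W,2^∞}` onto: rank BSD for `100 %` of `d ∈ 𝓕` and Goldfeld's `50 / 50` with BSD in `𝓕`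
(`bsdRank_and_goldfeld_goodTwists_leafHabitat_of_kolyvaginAtTwo`). This is LADDER-BSD §1 row S3's head
line («S3 ⇒ BSD-rank + Goldfeld for 100 % of good-at-2 twists of every such E») on the generic curve,
keyed on the two Kolyvagin-at-`2` cruxes instead of the whole leaf
(compare `TwoAdicGoodTwists.bsdRank_and_goldfeld_goodTwists[_mult]_of_nonCMTwoConverse`).

HONEST FRAMING. Nothing here proves the cruxes, the leaf or BSD: V1′ / V2♭ are OPEN at `p = 2`; Smith
2025, BFH 1990, Hoffstein–Luo 1997, `2`-parity, GZK, Kato/Kolyvagin finiteness, Gross–Zagier over `K`,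
Shimura reciprocity and modularity are named PRINT facts taken as hypotheses. Off the habitat (rational
`2`-torsion / `2`-isogeny / proper Rouse–Zureick-Brown image) and for `d ≢ 1 (mod 4)` nothing is said.
PARTITION (D-0054): none — RANK axis (S3); companion formula cells X5@2 good-ord (B1·O1, 611 classes, 436
big-image) and X5@2 mult (1 976 classes). BSD is not proved by any of this.

References: A. Smith, arXiv:2503.17619, Thm. 1.1, Cor. 1.2–1.3 [arXiv250317619]; W. Zhang, Camb. J. Math. 2
(2014), Thm. 1.1 [WZhang2014]; V. A. Kolyvagin, Math. Ann. 291 (1991), Thm. 4 [Kolyvagin1991MathAnn];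
D. Bump, S. Friedberg, J. Hoffstein, Invent. Math. 102 (1990) [BumpFriedbergHoffstein1990]; J. H. Silverman,
*AEC* (2009), VII.5, X.5, C.14 (Tate form) [SilvermanAEC2009]; M. R. Murty, V. K. Murty (1997), Ch. 6 §1
[MurtyMurty1997].
-/

set_option linter.dupNamespace false
set_option autoImplicit false

noncomputable section

open scoped Classical

open Filter Topology WeierstrassCurve Literature Literature.NumberTheory.EllipticCurves
  Literature.NumberTheory.EllipticCurves.ModularForms
  Literature.NumberTheory.EllipticCurves.Rank1Residual
  Summit.BirchSwinnertonDyer.BirchSwinnertonDyer.Theses.TwoAdicConverse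
  Summit.BirchSwinnertonDyer.BirchSwinnertonDyer.Theorems.GoldfeldGoodTwists
  Summit.BirchSwinnertonDyer.BirchSwinnertonDyer.Theorems.TwoAdicGoodTwists
  Summit.BirchSwinnertonDyer.BirchSwinnertonDyer.Theorems.TwoAdicKolyvaginRankZero

namespace Summit.BirchSwinnertonDyer.BirchSwinnertonDyer.Theorems.TwoAdicKolyvaginGoodTwists

/-! ## §0 The leaf habitat «non-CM, good-ordinary or multiplicative at `2`» is closed under `𝓕` -/

/-- **Good twists stay in the leaf's class.** For `W/ℚ` globally minimal, non-CM, good ordinary OR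
multiplicative at `2`, `d ≡ 1 (mod 4)` and a globally minimal `W'` with `C • W' = W^{(d)}`: `W'` is
non-CM and good ordinary or multiplicative at `2` (the same type as `W`): the two closure lemmas of
`TwoAdicConverseGoodTwists` / `TwoAdicConverseGoodTwistsMult`. [cite: SilvermanAEC2009, VII.5 Prop. 5.1, X.5 Cor. 5.4] -/
theorem not_hasCM_and_goodOrd_or_mult_of_smul_eq_quadraticTwist
    (W W' : WeierstrassCurve ℚ) [W.IsElliptic] [W.IsGloballyMinimal] [W'.IsElliptic]
    [W'.IsGloballyMinimal] (hCM : ¬ W.HasCM) (hred : GoodOrd W 2 ∨ Mult W 2) {d : ℤ} (hd4 : d % 4 = 1)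
    {C : VariableChange ℚ} (hC : C • W' = W.quadraticTwist (d : ℚ)) :
    ¬ W'.HasCM ∧ (GoodOrd W' 2 ∨ Mult W' 2) := by
  rcases hred with hgo | hm
  · obtain ⟨h1, h2⟩ := not_hasCM_and_goodOrd_of_smul_eq_quadraticTwist W W' hCM hgo hd4 hC
    exact ⟨h1, Or.inl h2⟩
  · obtain ⟨h1, h2⟩ := not_hasCM_and_mult_of_smul_eq_quadraticTwist W W' hCM hm hd4 hC
    exact ⟨h1, Or.inr h2⟩

/-! ## §1 One good twist of a big-image curve of the leaf habitat: rank BSD at Selmer corank `≤ 1` -/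

section OneTwist

/-- **Rank BSD for one good twist of a BIG-IMAGE curve, Selmer corank `≤ 1`, from Kolyvagin at
`2`.** For `W/ℚ` globally minimal, non-CM, good ordinary OR multiplicative at `2`, with `ρ̄_{W,2^m}` onto for all `m`,
and `d ≡ 1 (mod 4)` with `r := corank_{ℤ₂} Sel_{2^∞}(W^{(d)}/ℚ) ≤ 1`:
`ord_{s=1} L(W^{(d)}, s) = rank W^{(d)}(ℚ) = r` and `Ш(W^{(d)}/ℚ)` is finite. Transport to a minimal
model `W'` of `W^{(d)}` — again non-CM and of the same type at `2` (§0) AND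
big-image (F2 §0) — then F1's leaf on the
habitat (`nonCMTwoConverse_bigImage_of_kolyvaginAtTwo`: V1′ + V2♭ + `NoTwoTorsionOverK` +
`PrintedInputsRankOneAtTwo` + BFH + GZK) and GZK for rank and `Ш`.
[cite: arXiv250317619, §1 (the p-converse input of Cor. 1.2)] [cite: WZhang2014, Thm. 1.1 (shape)] -/
theorem bsdRank_quadraticTwist_of_selmerCorankTwoInfty_le_one_leafHabitat
    (hV1 : KolyvaginNonvanishingAtTwoFrame) (hV2 : KolyvaginCorankLowerBoundAtTwo)
    (hT : NoTwoTorsionOverK) (hIn : PrintedInputsRankOneAtTwo)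
    (hBFH : bumpFriedbergHoffstein_exists_heegnerField_split_twist_simpleZero)
    (hGZK : rank_eq_analyticRank_of_analyticRank_le_one)
    (W : WeierstrassCurve ℚ) [W.IsElliptic] [W.IsGloballyMinimal] (hCM : ¬ W.HasCM)
    (hred : GoodOrd W 2 ∨ Mult W 2) (hsur : ∀ m : ℕ, W.HasSurjectiveModNGaloisRep (2 ^ m : ℕ))
    {d : ℤ} (hd4 : d % 4 = 1) (hle : selmerCorankTwoInfty (W.quadraticTwist d) ≤ 1) :
    (W.quadraticTwist d).analyticRank = selmerCorankTwoInfty (W.quadraticTwist d) ∧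
      (W.quadraticTwist d).mordellWeilRank = selmerCorankTwoInfty (W.quadraticTwist d) ∧
        Finite (W.quadraticTwist d).sha := by
  have hd0 : ((d : ℤ) : ℚ) ≠ 0 := by exact_mod_cast (show d ≠ 0 by omega)
  haveI := W.isElliptic_quadraticTwist hd0
  obtain ⟨W', hW'ell, hW'min, C, hC⟩ := exists_isGloballyMinimal_smul_eq_quadraticTwist W hd0
  obtain ⟨hCM', hred'⟩ := not_hasCM_and_goodOrd_or_mult_of_smul_eq_quadraticTwist W W' hCM hred hd4 hC
  have hsur' := forall_hasSurjectiveModNGaloisRep_two_pow_of_smul_eq_quadraticTwist W W' hd0 hC hsur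
  have hcor' : W'.selmerCorank 2 = selmerCorankTwoInfty (W.quadraticTwist d) := by
    rw [selmerCorank_eq_of_variableChange 2 hC, ← selmerCorankTwoInfty_eq]
  have hW'r : W'.analyticRank = selmerCorankTwoInfty (W.quadraticTwist d) :=
    nonCMTwoConverse_bigImage_of_kolyvaginAtTwo hV1 hV2 hT hIn hBFH hGZK W' hCM' hred'
      hsur' _ hle hcor'
  have har : (W.quadraticTwist (d : ℚ)).analyticRank = selmerCorankTwoInfty (W.quadraticTwist d) := by
    rw [← hW'r, ← hC, analyticRank_smul]
  obtain ⟨hrank, hsha⟩ := hGZK (W.quadraticTwist (d : ℚ)) (by omega)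
  exact ⟨har, by rw [hrank, har], hsha⟩

end OneTwist

/-! ## §2 Rank BSD for `100 %` of `𝓕` and Goldfeld `50 / 50`, for every big-image curve -/

section Density

variable (W : WeierstrassCurve ℚ) [W.IsElliptic] [W.IsGloballyMinimal]

/-- **Rank BSD holds for `100 %` of the good quadratic twists of a big-image curve of the leaf habitat** (absolute form):
under V1′, V2♭, `NoTwoTorsionOverK`, `PrintedInputsRankOneAtTwo`, BFH, GZK and Smith's Thm. 1.1 for
`W` (non-CM, good ordinary or multiplicative at `2`, `ρ_{W,2^∞}` onto), the square-free `d` with "`d ≡ 1 (mod 4)` ⟹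
`ord_{s=1} L(W^{(d)}, s) = rank W^{(d)}(ℚ) ∧ Ш(W^{(d)}/ℚ)` finite" have density `1`.
[cite: arXiv250317619, Thm. 1.1 and Cor. 1.2] -/
theorem twistDensity_bsdRank_leafHabitat
    (hV1 : KolyvaginNonvanishingAtTwoFrame) (hV2 : KolyvaginCorankLowerBoundAtTwo)
    (hT : NoTwoTorsionOverK) (hIn : PrintedInputsRankOneAtTwo)
    (hBFH : bumpFriedbergHoffstein_exists_heegnerField_split_twist_simpleZero)
    (hGZK : rank_eq_analyticRank_of_analyticRank_le_one)
    (hCM : ¬ W.HasCM) (hred : GoodOrd W 2 ∨ Mult W 2) (hsur : ∀ m : ℕ, W.HasSurjectiveModNGaloisRep (2 ^ m : ℕ))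
    (hS : smith_selmerCorank_density W) :
    twistDensity (fun d ↦ d % 4 = 1 →
      (W.quadraticTwist d).analyticRank = (W.quadraticTwist d).mordellWeilRank ∧
        Finite (W.quadraticTwist d).sha) 1 := by
  refine twistDensity_one_mono (fun d _ hRd hd4 ↦ ?_) (twistDensity_selmerCorankTwoInfty_le_one_of W hS)
  obtain ⟨har, hrank, hsha⟩ := bsdRank_quadraticTwist_of_selmerCorankTwoInfty_le_one_leafHabitat
    hV1 hV2 hT hIn hBFH hGZK W hCM hred hsur hd4 hRd.2
  exact ⟨har.trans hrank.symm, hsha⟩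

/-- **Rank BSD for `100 %` of the good twists of a big-image curve of the leaf habitat** (relative form, with the
corank): for `d ∈ 𝓕` of relative density `1`,
`ord_{s=1} L(W^{(d)}, s) = rank W^{(d)}(ℚ) = corank_{ℤ₂} Sel_{2^∞}(W^{(d)}/ℚ) ≤ 1` and
`Ш(W^{(d)}/ℚ)` is finite. [cite: arXiv250317619, Thm. 1.1 and Cor. 1.2] -/
theorem tendsto_bsdRank_eq_selmerCorankTwoInfty_leafHabitat
    (hV1 : KolyvaginNonvanishingAtTwoFrame) (hV2 : KolyvaginCorankLowerBoundAtTwo)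
    (hT : NoTwoTorsionOverK) (hIn : PrintedInputsRankOneAtTwo)
    (hBFH : bumpFriedbergHoffstein_exists_heegnerField_split_twist_simpleZero)
    (hGZK : rank_eq_analyticRank_of_analyticRank_le_one)
    (hCM : ¬ W.HasCM) (hred : GoodOrd W 2 ∨ Mult W 2) (hsur : ∀ m : ℕ, W.HasSurjectiveModNGaloisRep (2 ^ m : ℕ))
    (hS : smith_selmerCorank_density W) :
    Tendsto (fun X : ℕ ↦ (Nat.card {d : ℤ | Squarefree d ∧ |d| ≤ (X : ℤ) ∧ (d % 4 = 1 ∧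
        (selmerCorankTwoInfty (W.quadraticTwist d) ≤ 1 ∧
          (W.quadraticTwist d).analyticRank = selmerCorankTwoInfty (W.quadraticTwist d) ∧
          (W.quadraticTwist d).mordellWeilRank = selmerCorankTwoInfty (W.quadraticTwist d) ∧
          Finite (W.quadraticTwist d).sha))} : ℝ) /
      Nat.card {d : ℤ | Squarefree d ∧ |d| ≤ (X : ℤ) ∧ d % 4 = 1}) atTop (𝓝 1) := by
  have hR := twistDensity_selmerCorankTwoInfty_le_one_of W hS
  have h0 : twistDensity (fun d ↦ ¬ (d ≠ 0 ∧ selmerCorankTwoInfty (W.quadraticTwist d) ≤ 1)) 0 := by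
    simpa using hR.compl
  refine tendsto_familyProportion_one_of_twistDensity_zero (h0.mono_zero fun d _ h hRd ↦ h.2 ?_)
  exact ⟨hRd.2, bsdRank_quadraticTwist_of_selmerCorankTwoInfty_le_one_leafHabitat hV1 hV2 hT hIn hBFH
    hGZK W hCM hred hsur h.1 hRd.2⟩

/-- The headline shape: for `100 %` of `d ∈ 𝓕`, `ord_{s=1} L(W^{(d)}, s) = rank W^{(d)}(ℚ)` and
`Ш(W^{(d)}/ℚ)` is finite, for a big-image `W`. [cite: arXiv250317619, Thm. 1.1 and Cor. 1.2] -/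
theorem tendsto_bsdRank_leafHabitat
    (hV1 : KolyvaginNonvanishingAtTwoFrame) (hV2 : KolyvaginCorankLowerBoundAtTwo)
    (hT : NoTwoTorsionOverK) (hIn : PrintedInputsRankOneAtTwo)
    (hBFH : bumpFriedbergHoffstein_exists_heegnerField_split_twist_simpleZero)
    (hGZK : rank_eq_analyticRank_of_analyticRank_le_one)
    (hCM : ¬ W.HasCM) (hred : GoodOrd W 2 ∨ Mult W 2) (hsur : ∀ m : ℕ, W.HasSurjectiveModNGaloisRep (2 ^ m : ℕ))
    (hS : smith_selmerCorank_density W) :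
    Tendsto (fun X : ℕ ↦ (Nat.card {d : ℤ | Squarefree d ∧ |d| ≤ (X : ℤ) ∧ (d % 4 = 1 ∧
        ((W.quadraticTwist d).analyticRank = (W.quadraticTwist d).mordellWeilRank ∧
          Finite (W.quadraticTwist d).sha))} : ℝ) /
      Nat.card {d : ℤ | Squarefree d ∧ |d| ≤ (X : ℤ) ∧ d % 4 = 1}) atTop (𝓝 1) := by
  have hR := twistDensity_selmerCorankTwoInfty_le_one_of W hS
  have h0 : twistDensity (fun d ↦ ¬ (d ≠ 0 ∧ selmerCorankTwoInfty (W.quadraticTwist d) ≤ 1)) 0 := by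
    simpa using hR.compl
  refine tendsto_familyProportion_one_of_twistDensity_zero (h0.mono_zero fun d _ h hRd ↦ h.2 ?_)
  obtain ⟨har, hrank, hsha⟩ := bsdRank_quadraticTwist_of_selmerCorankTwoInfty_le_one_leafHabitat
    hV1 hV2 hT hIn hBFH hGZK W hCM hred hsur h.1 hRd.2
  exact ⟨har.trans hrank.symm, hsha⟩

/-- **Goldfeld, odd half, with BSD, in `𝓕`, for a big-image curve**: among `d ∈ 𝓕`, `|d| ≤ X`, the
proportion with `ord_{s=1} L(W^{(d)}, s) = rank W^{(d)}(ℚ) = 1` and `Ш(W^{(d)}/ℚ)` finite tends to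
`1/2` (root numbers equidistribute in `𝓕`: Modularity, the first conjunct of item 23951).
[cite: arXiv250317619, Thm. 1.1 and Cor. 1.2] [cite: MurtyMurty1997, Ch. 6 §1] -/
theorem tendsto_familyProportion_rankOne_leafHabitat
    (hV1 : KolyvaginNonvanishingAtTwoFrame) (hV2 : KolyvaginCorankLowerBoundAtTwo)
    (hT : NoTwoTorsionOverK) (hIn : PrintedInputsRankOneAtTwo)
    (hBFH : bumpFriedbergHoffstein_exists_heegnerField_split_twist_simpleZero)
    (hGZK : rank_eq_analyticRank_of_analyticRank_le_one)
    (hCM : ¬ W.HasCM) (hred : GoodOrd W 2 ∨ Mult W 2) (hsur : ∀ m : ℕ, W.HasSurjectiveModNGaloisRep (2 ^ m : ℕ))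
    (hS : smith_selmerCorank_density W) :
    Tendsto (fun X : ℕ ↦ (Nat.card {d : ℤ | Squarefree d ∧ |d| ≤ (X : ℤ) ∧ (d % 4 = 1 ∧
        ((W.quadraticTwist d).analyticRank = 1 ∧ (W.quadraticTwist d).mordellWeilRank = 1 ∧
          Finite (W.quadraticTwist d).sha))} : ℝ) /
      Nat.card {d : ℤ | Squarefree d ∧ |d| ≤ (X : ℤ) ∧ d % 4 = 1}) atTop (𝓝 (1 / 2)) := by
  have hmod : exists_isNewformOf := hIn.1
  refine tendsto_familyProportion_of_congr_one
    (tendsto_familyProportion_rootNumber_eq_neg_one W hmod)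
    (tendsto_bsdRank_eq_selmerCorankTwoInfty_leafHabitat W hV1 hV2 hT hIn hBFH hGZK hCM hred hsur hS)
    fun d hd _ hR ↦ ?_
  obtain ⟨hle, hra, hrk, hsha⟩ := hR
  haveI := W.isElliptic_quadraticTwist (d := (d : ℚ)) (by exact_mod_cast hd.ne_zero)
  rw [rootNumber_eq_neg_one_iff_analyticRank_eq_one hmod _ (hra ▸ hle)]
  constructor
  · intro h1; exact ⟨h1, by rw [hrk, ← hra, h1], hsha⟩
  · exact fun h ↦ h.1

/-- **Goldfeld, even half, with BSD, in `𝓕`, for a big-image curve**: the proportion of `d ∈ 𝓕`,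
`|d| ≤ X`, with `ord_{s=1} L(W^{(d)}, s) = rank W^{(d)}(ℚ) = 0` and `Ш(W^{(d)}/ℚ)` finite tends to
`1/2`. [cite: arXiv250317619, Thm. 1.1 and Cor. 1.2] [cite: MurtyMurty1997, Ch. 6 §1] -/
theorem tendsto_familyProportion_rankZero_leafHabitat
    (hV1 : KolyvaginNonvanishingAtTwoFrame) (hV2 : KolyvaginCorankLowerBoundAtTwo)
    (hT : NoTwoTorsionOverK) (hIn : PrintedInputsRankOneAtTwo)
    (hBFH : bumpFriedbergHoffstein_exists_heegnerField_split_twist_simpleZero)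
    (hGZK : rank_eq_analyticRank_of_analyticRank_le_one)
    (hCM : ¬ W.HasCM) (hred : GoodOrd W 2 ∨ Mult W 2) (hsur : ∀ m : ℕ, W.HasSurjectiveModNGaloisRep (2 ^ m : ℕ))
    (hS : smith_selmerCorank_density W) :
    Tendsto (fun X : ℕ ↦ (Nat.card {d : ℤ | Squarefree d ∧ |d| ≤ (X : ℤ) ∧ (d % 4 = 1 ∧
        ((W.quadraticTwist d).analyticRank = 0 ∧ (W.quadraticTwist d).mordellWeilRank = 0 ∧
          Finite (W.quadraticTwist d).sha))} : ℝ) /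
      Nat.card {d : ℤ | Squarefree d ∧ |d| ≤ (X : ℤ) ∧ d % 4 = 1}) atTop (𝓝 (1 / 2)) := by
  have hmod : exists_isNewformOf := hIn.1
  refine tendsto_familyProportion_of_congr_one (tendsto_familyProportion_rootNumber_eq_one W hmod)
    (tendsto_bsdRank_eq_selmerCorankTwoInfty_leafHabitat W hV1 hV2 hT hIn hBFH hGZK hCM hred hsur hS)
    fun d hd _ hR ↦ ?_
  obtain ⟨hle, hra, hrk, hsha⟩ := hR
  haveI := W.isElliptic_quadraticTwist (d := (d : ℚ)) (by exact_mod_cast hd.ne_zero)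
  rw [rootNumber_eq_one_iff_analyticRank_eq_zero hmod _ (hra ▸ hle)]
  constructor
  · intro h0; exact ⟨h0, by rw [hrk, ← hra, h0], hsha⟩
  · exact fun h ↦ h.1

/-- **LADDER-BSD §1 row S3's head line for EVERY big-image curve, from Kolyvagin at `2`.** For every
globally minimal NON-CM `W/ℚ` good-ORDINARY OR MULTIPLICATIVE at `2` with SURJECTIVE `2`-adic image: rank BSD
(`ord_{s=1} L(W^{(d)}, s) = rank W^{(d)}(ℚ)`, `Ш(W^{(d)}/ℚ)` finite) for `100 %` of the good twists
`d ∈ 𝓕`, and Goldfeld's `50 / 50` with BSD in `𝓕` — from V1′ (item 24622) + V2♭ (item 24623) +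
`NoTwoTorsionOverK` (item 24405, proved) + `PrintedInputsRankOneAtTwo` (item 23951) + BFH + GZK +
Smith's Thm. 1.1 for `W`. Compare `TwoAdicGoodTwists.bsdRank_and_goldfeld_goodTwists[_mult]_of_nonCMTwoConverse`
(the same conclusion from the whole leaf, per reduction type): on the habitat the leaf is not needed beyond the two
Kolyvagin-at-`2` cruxes. [cite: arXiv250317619, Thm. 1.1 and Cor. 1.2] [cite: WZhang2014, Thm. 1.1 (shape)]
[cite: MurtyMurty1997, Ch. 6 §1] -/
theorem bsdRank_and_goldfeld_goodTwists_leafHabitat_of_kolyvaginAtTwo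
    (hV1 : KolyvaginNonvanishingAtTwoFrame) (hV2 : KolyvaginCorankLowerBoundAtTwo)
    (hT : NoTwoTorsionOverK) (hIn : PrintedInputsRankOneAtTwo)
    (hBFH : bumpFriedbergHoffstein_exists_heegnerField_split_twist_simpleZero)
    (hGZK : rank_eq_analyticRank_of_analyticRank_le_one)
    (hCM : ¬ W.HasCM) (hred : GoodOrd W 2 ∨ Mult W 2) (hsur : ∀ m : ℕ, W.HasSurjectiveModNGaloisRep (2 ^ m : ℕ))
    (hS : smith_selmerCorank_density W) :
    Tendsto (fun X : ℕ ↦ (Nat.card {d : ℤ | Squarefree d ∧ |d| ≤ (X : ℤ) ∧ (d % 4 = 1 ∧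
        ((W.quadraticTwist d).analyticRank = (W.quadraticTwist d).mordellWeilRank ∧
          Finite (W.quadraticTwist d).sha))} : ℝ) /
      Nat.card {d : ℤ | Squarefree d ∧ |d| ≤ (X : ℤ) ∧ d % 4 = 1}) atTop (𝓝 1) ∧
    Tendsto (fun X : ℕ ↦ (Nat.card {d : ℤ | Squarefree d ∧ |d| ≤ (X : ℤ) ∧ (d % 4 = 1 ∧
        ((W.quadraticTwist d).analyticRank = 0 ∧ (W.quadraticTwist d).mordellWeilRank = 0 ∧
          Finite (W.quadraticTwist d).sha))} : ℝ) /
      Nat.card {d : ℤ | Squarefree d ∧ |d| ≤ (X : ℤ) ∧ d % 4 = 1}) atTop (𝓝 (1 / 2)) ∧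
    Tendsto (fun X : ℕ ↦ (Nat.card {d : ℤ | Squarefree d ∧ |d| ≤ (X : ℤ) ∧ (d % 4 = 1 ∧
        ((W.quadraticTwist d).analyticRank = 1 ∧ (W.quadraticTwist d).mordellWeilRank = 1 ∧
          Finite (W.quadraticTwist d).sha))} : ℝ) /
      Nat.card {d : ℤ | Squarefree d ∧ |d| ≤ (X : ℤ) ∧ d % 4 = 1}) atTop (𝓝 (1 / 2)) :=
  ⟨tendsto_bsdRank_leafHabitat W hV1 hV2 hT hIn hBFH hGZK hCM hred hsur hS,
    tendsto_familyProportion_rankZero_leafHabitat W hV1 hV2 hT hIn hBFH hGZK hCM hred hsur hS,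
    tendsto_familyProportion_rankOne_leafHabitat W hV1 hV2 hT hIn hBFH hGZK hCM hred hsur hS⟩

end Density

end Summit.BirchSwinnertonDyer.BirchSwinnertonDyer.Theorems.TwoAdicKolyvaginGoodTwists

end
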